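import Mathlib
import Summits.ValiantsHypothesis.ValiantsHypothesis.Theorems.NewtonUnitEquationsTwoProductsRaySeries
/-! # Rung `stub_engineBinomialYSlopes` — crux `TwoProducts` (stmt-ValiantsHypothesis-5906), line `corner-log-linearization`
   BINOMIAL-IN-`Y` FACTORS WITH DISTINCT SLOPES.  Every factor `u_i`, `v_i` has constant term `1` and exactly two
   `Y`-levels: `u_i = α_i(X) + β_i(X)·Y^{d_i}` with `d_i ≥ 1`, `α_i(0) = 1`, arbitrary (any number of monomials, any
   degrees) univariate `α_i, β_i`; let `a_i := ord_X β_i` (the least `X`-degree on the top level) and call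
   `s_i := a_i / d_i` the SLOPE of the factor.  If the `2n` slopes are pairwise distinct then the set of stable south-west
   vertices of the truncated log series `Λ_R = Σ_{r=1}^{R} ((−1)^{r+1}/r) • (Σ_i (u_i − 1)^r − Σ_i (v_i − 1)^r)` has at
   most `2n + 1` elements: the `2n` LEADING LETTERS `(a_i, d_i)` and at most one point on the `X`-axis.
   Mechanism (rows of `Λ`, "level 0" of the lead's row/record picture): a monomial of `(u_i − 1)^r` has `Y`-degree
   `m·d_i` (`m ≤ r` top-level letters used) and `X`-degree `≥ m·a_i + (r − m)`; so row `q ≥ 1` of `Λ_R` starts at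
   `X`-order `≥ q·min{s_j : d_j ∣ q}` and — the slopes being distinct, no cancellation is possible — the leading letter
   `(a_j, d_j)` of the factor `j` of least slope among those with `d_j ∣ q` lies in `supp Λ_R` (its coefficient is
   `± lc_j`, only `r = 1` of factor `j` reaches it) and is componentwise `≤` any point of row `q`; a stable unique
   minimiser for positive weights is therefore that leading letter itself.  Generalises the binomial rung `t ≤ 2` in the
   direction "arbitrary univariate coefficients" (the ray rung `RayFactors` generalises it in the direction "arbitrary
   univariate polynomial in one monomial"); uniform in `t` and in all degrees. [folklore] -/
set_option linter.dupNamespace false -- single-conjunct summit: `ValiantsHypothesis.ValiantsHypothesis`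
namespace Summit.ValiantsHypothesis.ValiantsHypothesis.Theorems.TwoProducts.BinomialY
open scoped BigOperators Pointwise
open MvPolynomial
open Summit.ValiantsHypothesis.ValiantsHypothesis.Theorems.TwoProducts.RaySeries (eq_of_mem_ray)

/-! ## One factor with two `Y`-levels -/

section OneFactor

variable (f : MvPolynomial (Fin 2) ℂ) (A D : ℕ)

/-- A monomial of `f − 1` (`f` with constant term `1`) is a nonzero monomial of `f`. [folklore] -/
theorem mem_support_of_mem_support_sub_one (h0 : coeff 0 f = 1) {e : Fin 2 →₀ ℕ} (he : e ∈ (f - 1).support) :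
    e ≠ 0 ∧ e ∈ f.support := by
  rw [mem_support_iff, coeff_sub, coeff_one] at he
  by_cases h : e = 0
  · subst h; simp [h0] at he
  · refine ⟨h, ?_⟩
    rw [mem_support_iff]
    simpa [Ne.symm h] using he

/-- A nonzero exponent with vanishing `Y`-coordinate has `X`-coordinate `≥ 1`. [folklore] -/
theorem one_le_apply_zero {e : Fin 2 →₀ ℕ} (hne : e ≠ 0) (h1 : e 1 = 0) : 1 ≤ e 0 := by
  by_contra h
  push Not at h
  apply hne
  ext i
  fin_cases i
  · simpa using h
  · simpa using h1

/-- SHAPE of the powers: for a factor with constant term `1` whose monomials have `Y`-degree `0` or `D`, the top-level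
ones having `X`-degree `≥ A`, every monomial of `(f − 1)^r` has `Y`-degree `m·D` for some `m ≤ r` and `X`-degree
`≥ m·A + (r − m)`. [folklore] -/
theorem shape (h0 : coeff 0 f = 1) (h1 : ∀ e ∈ f.support, e 1 = 0 ∨ e 1 = D)
    (h2 : ∀ e ∈ f.support, e 1 = D → A ≤ e 0) :
    ∀ r : ℕ, ∀ e ∈ ((f - 1) ^ r).support, ∃ m ≤ r, e 1 = m * D ∧ m * A + (r - m) ≤ e 0 := by
  classical
  intro r
  induction r with
  | zero =>
    intro e he
    rw [pow_zero, support_one, Finset.mem_singleton] at he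
    subst he
    exact ⟨0, le_rfl, by simp, by simp⟩
  | succ r ih =>
    intro e he
    rw [pow_succ] at he
    obtain ⟨e₁, he₁, e₂, he₂, rfl⟩ := Finset.mem_add.mp (support_mul _ _ he)
    obtain ⟨m, hm, hm1, hm0⟩ := ih e₁ he₁
    obtain ⟨hne, hf⟩ := mem_support_of_mem_support_sub_one f h0 he₂
    rcases h1 e₂ hf with h | h
    · have hx := one_le_apply_zero hne h
      refine ⟨m, by omega, ?_, ?_⟩
      · simp only [Finsupp.coe_add, Pi.add_apply, h, hm1, add_zero]
      · simp only [Finsupp.coe_add, Pi.add_apply]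
        have : m * A + (r + 1 - m) = m * A + (r - m) + 1 := by omega
        omega
    · have hx := h2 e₂ hf h
      refine ⟨m + 1, by omega, ?_, ?_⟩
      · simp only [Finsupp.coe_add, Pi.add_apply, h, hm1]; ring
      · simp only [Finsupp.coe_add, Pi.add_apply]
        have : (m + 1) * A + (r + 1 - (m + 1)) = m * A + (r - m) + A := by
          rw [add_mul, one_mul]; omega
        omega

/-- The LEADING LETTER `(A, D)` as an exponent vector. [folklore] -/
theorem leader_apply (A D : ℕ) :
    (Finsupp.single 0 A + Finsupp.single 1 D : Fin 2 →₀ ℕ) 0 = A ∧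
      (Finsupp.single 0 A + Finsupp.single 1 D : Fin 2 →₀ ℕ) 1 = D := by
  constructor <;> simp

/-- Only the first power sees the leading letter: `coeff_{(A,D)} (f − 1)^r = [r = 1]·coeff_{(A,D)} f` (`D ≥ 1`). [folklore] -/
theorem coeff_leader_pow (h0 : coeff 0 f = 1) (h1 : ∀ e ∈ f.support, e 1 = 0 ∨ e 1 = D)
    (h2 : ∀ e ∈ f.support, e 1 = D → A ≤ e 0) (hD : 0 < D) (r : ℕ) :
    coeff (Finsupp.single 0 A + Finsupp.single 1 D) ((f - 1) ^ r) =
      if r = 1 then coeff (Finsupp.single 0 A + Finsupp.single 1 D) f else 0 := by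
  classical
  obtain ⟨hl0, hl1⟩ := leader_apply A D
  have hl : (Finsupp.single 0 A + Finsupp.single 1 D : Fin 2 →₀ ℕ) ≠ 0 := by
    intro h
    have := congrArg (fun e => e 1) h
    simp only [Finsupp.coe_zero, Pi.zero_apply] at this
    omega
  split_ifs with hr
  · subst hr
    rw [pow_one, coeff_sub, coeff_one, if_neg (Ne.symm hl), sub_zero]
  · by_contra hne
    obtain ⟨m, hm, hm1, hm0⟩ := shape f A D h0 h1 h2 r _ (mem_support_iff.mpr hne)
    rw [hl1] at hm1
    rw [hl0] at hm0
    have hm' : m = 1 := by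
      have : 1 * D = m * D := by omega
      exact (Nat.eq_of_mul_eq_mul_right hD this).symm
    subst hm'
    omega

end OneFactor

/-! ## A signed family of such factors with pairwise distinct slopes -/

section Family

variable {κ : Type*} [Fintype κ] (G : κ → MvPolynomial (Fin 2) ℂ) (s : κ → ℂ) (dd aa : κ → ℕ)

/-- A monomial of the truncated signed log power sum is a monomial of some `(G k − 1)^r`, `1 ≤ r ≤ R`. [folklore] -/
theorem exists_of_mem_support_LS (R : ℕ) {e : Fin 2 →₀ ℕ}
    (he : e ∈ (∑ r ∈ Finset.Icc 1 R, ((-1 : ℂ) ^ (r + 1) / (r : ℂ)) • ∑ k, s k • (G k - 1) ^ r).support) :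
    ∃ r ∈ Finset.Icc 1 R, ∃ k, e ∈ ((G k - 1) ^ r).support := by
  classical
  obtain ⟨r, hr, hr'⟩ := Finset.mem_biUnion.mp (support_sum he)
  obtain ⟨k, -, hk⟩ := Finset.mem_biUnion.mp (support_sum (support_smul hr'))
  exact ⟨r, hr, k, support_smul hk⟩

/-- MAIN LEMMA.  For a signed family of two-level factors (constant terms `1`, levels `0` and `dd k ≥ 1`, least top-level
`X`-degree `aa k` attained) with pairwise distinct slopes `aa k / dd k` and nonzero signs, the stable south-west vertices
of the truncated signed log power sums are leading letters or lie on the `X`-axis: at most `card κ + 1` of them. [folklore] -/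
theorem ncard_logVert_le (hs : ∀ k, s k ≠ 0) (h0 : ∀ k, coeff 0 (G k) = 1) (hd : ∀ k, 0 < dd k)
    (h1 : ∀ k, ∀ e ∈ (G k).support, e 1 = 0 ∨ e 1 = dd k)
    (h2 : ∀ k, ∀ e ∈ (G k).support, e 1 = dd k → aa k ≤ e 0)
    (h3 : ∀ k, (Finsupp.single 0 (aa k) + Finsupp.single 1 (dd k) : Fin 2 →₀ ℕ) ∈ (G k).support)
    (h4 : ∀ k k', k ≠ k' → aa k * dd k' ≠ aa k' * dd k) :
    {e : Fin 2 →₀ ℕ | ∃ w : Fin 2 → ℤ, 0 < w 0 ∧ 0 < w 1 ∧ ∀ R : ℕ, w 0 * (e 0 : ℤ) + w 1 * (e 1 : ℤ) < (R : ℤ) →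
      (e ∈ (∑ r ∈ Finset.Icc 1 R, ((-1 : ℂ) ^ (r + 1) / (r : ℂ)) • ∑ k, s k • (G k - 1) ^ r).support ∧
        ∀ e' ∈ (∑ r ∈ Finset.Icc 1 R, ((-1 : ℂ) ^ (r + 1) / (r : ℂ)) • ∑ k, s k • (G k - 1) ^ r).support, e' ≠ e →
          w 0 * (e 0 : ℤ) + w 1 * (e 1 : ℤ) < w 0 * (e' 0 : ℤ) + w 1 * (e' 1 : ℤ))}.ncard ≤ Fintype.card κ + 1 := by
  classical
  set LV := {e : Fin 2 →₀ ℕ | ∃ w : Fin 2 → ℤ, 0 < w 0 ∧ 0 < w 1 ∧ ∀ R : ℕ, w 0 * (e 0 : ℤ) + w 1 * (e 1 : ℤ) < (R : ℤ) →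
      (e ∈ (∑ r ∈ Finset.Icc 1 R, ((-1 : ℂ) ^ (r + 1) / (r : ℂ)) • ∑ k, s k • (G k - 1) ^ r).support ∧
        ∀ e' ∈ (∑ r ∈ Finset.Icc 1 R, ((-1 : ℂ) ^ (r + 1) / (r : ℂ)) • ∑ k, s k • (G k - 1) ^ r).support, e' ≠ e →
          w 0 * (e 0 : ℤ) + w 1 * (e 1 : ℤ) < w 0 * (e' 0 : ℤ) + w 1 * (e' 1 : ℤ))} with hLV
  -- the leading letters and the slopes
  set ld : κ → (Fin 2 →₀ ℕ) := fun k => Finsupp.single 0 (aa k) + Finsupp.single 1 (dd k) with hld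
  have ld0 : ∀ k, ld k 0 = aa k := fun k => (leader_apply (aa k) (dd k)).1
  have ld1 : ∀ k, ld k 1 = dd k := fun k => (leader_apply (aa k) (dd k)).2
  set sl : κ → ℚ := fun k => (aa k : ℚ) / (dd k : ℚ) with hsl
  have hdq : ∀ k, (0 : ℚ) < dd k := fun k => by exact_mod_cast hd k
  -- equal slopes force equal indices
  have sl_inj : ∀ k k', sl k = sl k' → k = k' := by
    intro k k' h
    by_contra hne
    apply h4 k k' hne
    have h' : (aa k : ℚ) * dd k' = aa k' * dd k := by
      simp only [hsl] at h
      exact (div_eq_div_iff (hdq k).ne' (hdq k').ne').mp h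
    exact_mod_cast h'
  -- the coefficient of a leading letter `ld k*` in `(G k − 1)^r` when `k*` has least slope among the `k` with `dd k ∣ dd k*`
  have cross : ∀ (kstar k : κ) (r : ℕ), k ≠ kstar → (dd k ∣ dd kstar → sl kstar ≤ sl k) →
      coeff (ld kstar) ((G k - 1) ^ r) = 0 := by
    intro kstar k r hne hmin
    by_contra hc
    obtain ⟨m, -, hm1, hm0⟩ := shape (G k) (aa k) (dd k) (h0 k) (h1 k) (h2 k) r _ (mem_support_iff.mpr hc)
    rw [ld1] at hm1
    rw [ld0] at hm0
    have hmpos : 0 < m := by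
      rcases Nat.eq_zero_or_pos m with h | h
      · rw [h, zero_mul] at hm1; exact absurd hm1 (hd kstar).ne'
      · exact h
    have hdiv : dd k ∣ dd kstar := ⟨m, by rw [hm1, mul_comm]⟩
    have hle := hmin hdiv
    -- slope k ≤ slope k* from `m·aa k ≤ aa k*` and `dd k* = m·dd k`
    have hle' : sl k ≤ sl kstar := by
      simp only [hsl]
      rw [div_le_div_iff₀ (hdq k) (hdq kstar)]
      have e1 : (dd kstar : ℚ) = m * dd k := by exact_mod_cast hm1
      have e2 : (m : ℚ) * aa k ≤ aa kstar := by exact_mod_cast (le_of_add_le_left hm0)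
      rw [e1]
      have := hdq k
      nlinarith
    exact hne (sl_inj _ _ (le_antisymm hle' hle))
  -- every element of LV off the X-axis is a leading letter
  have key : ∀ e ∈ LV, e 1 ≠ 0 → ∃ k, e = ld k := by
    intro e he hq
    obtain ⟨w, hw0, hw1, hst⟩ := he
    have hR : w 0 * (e 0 : ℤ) + w 1 * (e 1 : ℤ) <
        (((w 0 * (e 0 : ℤ) + w 1 * (e 1 : ℤ)).toNat + 1 : ℕ) : ℤ) := by
      have := Int.self_le_toNat (w 0 * (e 0 : ℤ) + w 1 * (e 1 : ℤ)); push_cast; omega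
    obtain ⟨hmem, hmin⟩ := hst _ hR
    obtain ⟨r, hr, k₀, hk₀⟩ := exists_of_mem_support_LS G s _ hmem
    obtain ⟨m, -, hm1, hm0⟩ := shape (G k₀) (aa k₀) (dd k₀) (h0 k₀) (h1 k₀) (h2 k₀) r e hk₀
    have hmpos : 0 < m := by
      rcases Nat.eq_zero_or_pos m with h | h
      · rw [h, zero_mul] at hm1; exact absurd hm1 hq
      · exact h
    -- the least slope among the factors whose level divides `q = e 1`
    set S : Finset κ := Finset.univ.filter fun k => dd k ∣ e 1 with hS
    have hk₀S : k₀ ∈ S := Finset.mem_filter.mpr ⟨Finset.mem_univ _, ⟨m, by rw [hm1, mul_comm]⟩⟩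
    obtain ⟨kstar, hkS, hkmin⟩ := S.exists_min_image sl ⟨k₀, hk₀S⟩
    have hkdiv : dd kstar ∣ e 1 := (Finset.mem_filter.mp hkS).2
    -- `ld kstar` lies in the support of every truncated log power sum
    have hsupp : ∀ R : ℕ, 1 ≤ R →
        ld kstar ∈ (∑ r ∈ Finset.Icc 1 R, ((-1 : ℂ) ^ (r + 1) / (r : ℂ)) • ∑ k, s k • (G k - 1) ^ r).support := by
      intro R hR1
      rw [mem_support_iff, coeff_sum]
      have inner : ∀ r' : ℕ, coeff (ld kstar) (((-1 : ℂ) ^ (r' + 1) / (r' : ℂ)) • ∑ k, s k • (G k - 1) ^ r') =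
          ((-1 : ℂ) ^ (r' + 1) / (r' : ℂ)) * (s kstar * if r' = 1 then coeff (ld kstar) (G kstar) else 0) := by
        intro r'
        rw [coeff_smul, coeff_sum, smul_eq_mul]
        congr 1
        rw [Finset.sum_eq_single kstar]
        · rw [coeff_smul, smul_eq_mul, hld, coeff_leader_pow (G kstar) (aa kstar) (dd kstar) (h0 kstar) (h1 kstar)
            (h2 kstar) (hd kstar) r']
        · intro k _ hne
          rw [coeff_smul, smul_eq_mul, cross kstar k r' hne (fun hdv => hkmin k
            (Finset.mem_filter.mpr ⟨Finset.mem_univ _, hdv.trans hkdiv⟩)), mul_zero]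
        · intro h; exact absurd (Finset.mem_univ _) h
      simp_rw [inner]
      rw [Finset.sum_eq_single 1]
      · simp only [if_true]
        have hlc : coeff (ld kstar) (G kstar) ≠ 0 := mem_support_iff.mp (h3 kstar)
        norm_num
        exact ⟨hs kstar, hlc⟩
      · intro r' _ hr'
        rw [if_neg hr']; ring
      · intro h
        exact absurd (Finset.mem_Icc.mpr ⟨le_rfl, hR1⟩) h
    -- `ld kstar ≤ e` componentwise, via the slopes
    have hle1 : dd kstar ≤ e 1 := Nat.le_of_dvd (Nat.pos_of_ne_zero hq) hkdiv
    have hle0 : aa kstar ≤ e 0 := by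
      have hs0 : sl kstar ≤ sl k₀ := hkmin k₀ hk₀S
      have e1 : (e 1 : ℚ) = m * dd k₀ := by exact_mod_cast hm1
      have e2 : (m : ℚ) * aa k₀ ≤ e 0 := by exact_mod_cast (le_of_add_le_left hm0)
      have e3 : (dd kstar : ℚ) ≤ e 1 := by exact_mod_cast hle1
      simp only [hsl] at hs0
      rw [div_le_div_iff₀ (hdq kstar) (hdq k₀)] at hs0
      have hk0 := hdq k₀
      have hks := hdq kstar
      have haa : (0 : ℚ) ≤ aa kstar := by exact_mod_cast Nat.zero_le _
      -- aa k* · dd k₀ ≤ aa k₀ · dd k*;  e0 ≥ m aa k₀ = (e1/dd k₀) aa k₀ ≥ (e1/dd k₀)(aa k* dd k₀ / dd k*) = e1 aa k*/dd k* ≥ aa k*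
      have : (aa kstar : ℚ) ≤ e 0 := by
        have h5 : (aa kstar : ℚ) * dd kstar ≤ (aa kstar : ℚ) * (e 1) := by nlinarith
        nlinarith
      exact_mod_cast this
    -- strict minimality forces `e = ld kstar`
    refine ⟨kstar, ?_⟩
    by_contra hne
    have h1R : 1 ≤ (w 0 * (e 0 : ℤ) + w 1 * (e 1 : ℤ)).toNat + 1 := by omega
    have hlt := hmin (ld kstar) (hsupp _ h1R) (Ne.symm hne)
    rw [ld0, ld1] at hlt
    have c0 : (aa kstar : ℤ) ≤ e 0 := by exact_mod_cast hle0
    have c1 : (dd kstar : ℤ) ≤ e 1 := by exact_mod_cast hle1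
    nlinarith
  -- the X-axis part of LV has at most one element
  have axis : ∀ e ∈ LV, ∀ e' ∈ LV, e 1 = 0 → e' 1 = 0 → e = e' := by
    intro e he e' he' h h'
    obtain ⟨w, hw0, hw1, hst⟩ := he
    obtain ⟨w', hw0', hw1', hst'⟩ := he'
    have hg : ∀ f : Fin 2 →₀ ℕ, f 1 = 0 → f = (f 0) • (Finsupp.single 0 1 : Fin 2 →₀ ℕ) := by
      intro f hf; ext i; fin_cases i <;> simp [hf]
    exact eq_of_mem_ray (fun R => (∑ r ∈ Finset.Icc 1 R, ((-1 : ℂ) ^ (r + 1) / (r : ℂ)) •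
        ∑ k, s k • (G k - 1) ^ r).support) (Finsupp.single 0 1) e e' (e 0) (e' 0) (hg e h) (hg e' h')
      w w' hw0 hw1 hw0' hw1' hst hst'
  -- counting
  have hss : (LV ∩ {e | e 1 = 0}).Subsingleton := fun e he e' he' => axis e he.1 e' he'.1 he.2 he'.2
  have hfin2 : (LV ∩ {e | e 1 = 0}).Finite := hss.finite
  have hfin_ax : (LV ∩ {e | e 1 = 0}).ncard ≤ 1 := (Set.ncard_le_one hfin2).mpr fun e he e' he' => hss he he'
  have hsub : LV ⊆ Set.range ld ∪ (LV ∩ {e | e 1 = 0}) := by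
    intro e he
    by_cases hq : e 1 = 0
    · exact Or.inr ⟨he, hq⟩
    · obtain ⟨k, hk⟩ := key e he hq
      exact Or.inl ⟨k, hk.symm⟩
  have hrange : (Set.range ld).ncard ≤ Fintype.card κ := by
    rw [← Set.image_univ]
    exact (Set.ncard_image_le Set.finite_univ).trans (by rw [Set.ncard_univ, Nat.card_eq_fintype_card])
  calc LV.ncard ≤ (Set.range ld ∪ (LV ∩ {e | e 1 = 0})).ncard :=
        Set.ncard_le_ncard hsub ((Set.finite_range ld).union hfin2)
    _ ≤ (Set.range ld).ncard + (LV ∩ {e | e 1 = 0}).ncard := Set.ncard_union_le _ _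
    _ ≤ Fintype.card κ + 1 := add_le_add hrange hfin_ax

end Family

/-! ## The registered rung -/

/-- RUNG `stub_engineBinomialYSlopes` (registered vocabulary).  Factors `u_i = α_i(X) + β_i(X)Y^{d_i}`,
`v_i = α'_i(X) + β'_i(X)Y^{d'_i}` with constant terms `1`, `d_i, d'_i ≥ 1`, least top-level `X`-degrees `a_i, a'_i`
(attained), and pairwise distinct slopes (`a_i d_j ≠ a_j d_i` etc., cross-multiplied): the stable south-west log vertices
number at most `2n + 1`. [folklore] -/
theorem stub_engineBinomialYSlopes : ∀ (n : ℕ) (u v : Fin n → MvPolynomial (Fin 2) ℂ) (d a d' a' : Fin n → ℕ),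
    (∀ i, MvPolynomial.coeff 0 (u i) = 1) → (∀ i, MvPolynomial.coeff 0 (v i) = 1) →
    (∀ i, 0 < d i) → (∀ i, 0 < d' i) →
    (∀ i, ∀ e ∈ (u i).support, e 1 = 0 ∨ e 1 = d i) → (∀ i, ∀ e ∈ (v i).support, e 1 = 0 ∨ e 1 = d' i) →
    (∀ i, ∀ e ∈ (u i).support, e 1 = d i → a i ≤ e 0) → (∀ i, ∀ e ∈ (v i).support, e 1 = d' i → a' i ≤ e 0) →
    (∀ i, (Finsupp.single 0 (a i) + Finsupp.single 1 (d i) : Fin 2 →₀ ℕ) ∈ (u i).support) →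
    (∀ i, (Finsupp.single 0 (a' i) + Finsupp.single 1 (d' i) : Fin 2 →₀ ℕ) ∈ (v i).support) →
    (∀ i j, i ≠ j → a i * d j ≠ a j * d i) → (∀ i j, i ≠ j → a' i * d' j ≠ a' j * d' i) →
    (∀ i j, a i * d' j ≠ a' j * d i) →
    {e : Fin 2 →₀ ℕ | ∃ w : Fin 2 → ℤ, 0 < w 0 ∧ 0 < w 1 ∧ ∀ R : ℕ, w 0 * (e 0 : ℤ) + w 1 * (e 1 : ℤ) < (R : ℤ) →
      (e ∈ (∑ r ∈ Finset.Icc 1 R, ((-1 : ℂ) ^ (r + 1) / (r : ℂ)) •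
            (∑ i, (u i - 1) ^ r - ∑ i, (v i - 1) ^ r)).support ∧
        ∀ e' ∈ (∑ r ∈ Finset.Icc 1 R, ((-1 : ℂ) ^ (r + 1) / (r : ℂ)) •
            (∑ i, (u i - 1) ^ r - ∑ i, (v i - 1) ^ r)).support, e' ≠ e →
          w 0 * (e 0 : ℤ) + w 1 * (e 1 : ℤ) < w 0 * (e' 0 : ℤ) + w 1 * (e' 1 : ℤ))}.ncard ≤ 2 * n + 1 := by
  intro n u v d a d' a' hu0 hv0 hd hd' h1 h1' h2 h2' h3 h3' huu hvv huv
  classical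
  have hsum : ∀ r : ℕ, (∑ i, (u i - 1) ^ r - ∑ i, (v i - 1) ^ r) =
      ∑ k : Fin n ⊕ Fin n, Sum.elim (fun _ => (1 : ℂ)) (fun _ => -1) k • (Sum.elim u v k - 1) ^ r := by
    intro r
    rw [Fintype.sum_sum_type]
    simp [sub_eq_add_neg, Finset.sum_neg_distrib]
  simp only [hsum]
  have key := ncard_logVert_le (κ := Fin n ⊕ Fin n) (Sum.elim u v) (Sum.elim (fun _ => (1 : ℂ)) (fun _ => -1))
    (Sum.elim d d') (Sum.elim a a')
    (by rintro (i | i) <;> simp) (by rintro (i | i); exacts [hu0 i, hv0 i]) (by rintro (i | i); exacts [hd i, hd' i])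
    (by rintro (i | i); exacts [h1 i, h1' i]) (by rintro (i | i); exacts [h2 i, h2' i])
    (by rintro (i | i); exacts [h3 i, h3' i])
    (by
      rintro (i | i) (j | j) hne
      · exact huu i j fun h => hne (by rw [h])
      · exact huv i j
      · intro h
        exact huv j i (by simpa [mul_comm] using h.symm)
      · exact hvv i j fun h => hne (by rw [h]))
  rw [Fintype.card_sum, Fintype.card_fin] at key
  convert key using 1
  ring

end Summit.ValiantsHypothesis.ValiantsHypothesis.Theorems.TwoProducts.BinomialY
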